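import Literature.AnabelianGeometry.AbsoluteAnabelian.AbsAnabFundamentalGroups
import HarnessLib

/-!
# [AbsAnab] §0 — NON-VACUITY of the type record `FundamentalExtension.HyperbolicType`
# (row «NV-L4/FundamentalExtension.HyperbolicType»)

Mochizuki, *The absolute anabelian geometry of hyperbolic curves* [AbsAnab], §0 "Curves" p. 4 (the type `(g, r)` of a
hyperbolic curve, `2g − 2 + r > 0`); typed by abc-iut-L4-t4 in `AbsAnabFundamentalGroups.lean` as
`HyperbolicType = (g, r, hyp : PuncturedSurfaceGroup.IsHyperbolicType g r)` with `IsHyperbolicType g r := 2 < 2g + r`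
([SemiAnbd] §0, `PuncturedSurfaceGroup.lean`). PROOF-ONLY companion (no `def`, no `instance`, no `structure`).
abc-iut-w5-d197's INHABITATION CENSUS L4 v1 (§A) lists `HyperbolicType` with ZERO producers. GENUINE witnesses — the
types that actually occur:

* `HyperbolicType.exists_oncePuncturedElliptic` — `(g, r) = (1, 1)`, the once-punctured elliptic curve `X` of
  [IUTchI] Def 3.1 (b) (the case the whole corpus is about);
* `exists_thricePuncturedLine` — `(0, 3)`, `ℙ¹ ∖ {0, 1, ∞}`; `exists_of_isHyperbolicType` — every hyperbolic pair;
* `nonempty_iff` — the EXACT criterion `Nonempty HyperbolicType ↔ ∃ g r, 2 < 2g + r` (true);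
* `not_isHyperbolicType_*` — the excluded non-hyperbolic types `(0,0), (0,1), (0,2), (1,0)` do NOT give a record
  (sanity: the `hyp` field is not idle).

Nothing of [AbsAnab] is asserted. [cite: MochizukiAbsAnab2004, §0 p.4]
-/

namespace Literature.AnabelianGeometry.AbsoluteAnabelian

namespace FundamentalExtension

open Literature.GroupTheory.CombinatorialGroupTheory.PuncturedSurfaceGroup (IsHyperbolicType)

namespace HyperbolicType

/-- **AbsAnab:§0** (kurims p.4) Every hyperbolic pair `(g, r)` (`2 < 2g + r`) is a `HyperbolicType`.
[cite: MochizukiAbsAnab2004, §0 p.4] -/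
theorem exists_of_isHyperbolicType (g r : ℕ) (h : IsHyperbolicType g r) :
    ∃ t : HyperbolicType, t.g = g ∧ t.r = r :=
  ⟨⟨g, r, h⟩, rfl, rfl⟩

/-- **AbsAnab:§0** (kurims p.4) EXACT CRITERION (and it holds): `HyperbolicType` is inhabited iff some pair is
hyperbolic. [cite: MochizukiAbsAnab2004, §0 p.4] -/
theorem nonempty_iff : Nonempty HyperbolicType ↔ ∃ g r : ℕ, IsHyperbolicType g r :=
  ⟨fun ⟨t⟩ => ⟨t.g, t.r, t.hyp⟩, fun ⟨g, r, h⟩ => ⟨⟨g, r, h⟩⟩⟩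

/-- **AbsAnab:§0** (kurims p.4) GENUINE: the type `(1, 1)` of a ONCE-PUNCTURED ELLIPTIC CURVE ([IUTchI] Def 3.1 (b):
`X_F` = `E_F` minus the origin) is hyperbolic: `2 < 2·1 + 1`. [cite: MochizukiAbsAnab2004, §0 p.4] -/
theorem exists_oncePuncturedElliptic : ∃ t : HyperbolicType, t.g = 1 ∧ t.r = 1 :=
  exists_of_isHyperbolicType 1 1 (by unfold IsHyperbolicType; decide)

/-- **AbsAnab:§0** (kurims p.4) GENUINE: the type `(0, 3)` of the THRICE-PUNCTURED PROJECTIVE LINE is hyperbolic: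
`2 < 0 + 3`. [cite: MochizukiAbsAnab2004, §0 p.4] -/
theorem exists_thricePuncturedLine : ∃ t : HyperbolicType, t.g = 0 ∧ t.r = 3 :=
  exists_of_isHyperbolicType 0 3 (by unfold IsHyperbolicType; decide)

/-- **AbsAnab:§0** (kurims p.4) GENUINE: every PROPER curve of genus `g ≥ 2` has hyperbolic type `(g, 0)`.
[cite: MochizukiAbsAnab2004, §0 p.4] -/
theorem exists_proper (g : ℕ) (hg : 2 ≤ g) : ∃ t : HyperbolicType, t.g = g ∧ t.r = 0 :=
  exists_of_isHyperbolicType g 0 (by unfold IsHyperbolicType; omega)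

/-- **AbsAnab:§0** (kurims p.4) The interface is inhabited (closed term `(1, 1)`). [cite: MochizukiAbsAnab2004, §0 p.4] -/
theorem nonempty_model : Nonempty HyperbolicType :=
  let ⟨t, _⟩ := exists_oncePuncturedElliptic; ⟨t⟩

/-- **AbsAnab:§0** (kurims p.4) Sanity (the `hyp` field is not idle): the four NON-hyperbolic types carry no record —
`(0,0)` (`ℙ¹`), `(0,1)` (`𝔸¹`), `(0,2)` (`𝔾_m`), `(1,0)` (an elliptic curve). [cite: MochizukiAbsAnab2004, §0 p.4] -/
theorem not_isHyperbolicType_of_le {g r : ℕ} (h : 2 * g + r ≤ 2) : ¬ ∃ t : HyperbolicType, t.g = g ∧ t.r = r := by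
  rintro ⟨t, rfl, rfl⟩
  have := t.hyp
  unfold IsHyperbolicType at this
  omega

/-- **AbsAnab:§0** (kurims p.4) In particular no `HyperbolicType` has `(g, r) = (1, 0)` (a complete elliptic curve is
not hyperbolic — the puncture of [IUTchI] Def 3.1 (b) is what makes `X` hyperbolic). [cite: MochizukiAbsAnab2004, §0 p.4] -/
theorem not_exists_elliptic : ¬ ∃ t : HyperbolicType, t.g = 1 ∧ t.r = 0 :=
  not_isHyperbolicType_of_le (by norm_num)

end HyperbolicType

end FundamentalExtension

end Literature.AnabelianGeometry.AbsoluteAnabelian
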